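import Summits.HodgeConjecture.HodgeConjecture.Theorems.LinearSystemTorelliDefs
import Literature.AlgebraicGeometry.HodgeTheory.AbelianVarietyEndomorphismsHOne
import Mathlib.RingTheory.Polynomial.Pochhammer
import Mathlib.Algebra.MvPolynomial.CommRing

/-!
# Route LinearSystemTorelli — crux `MiddleDivisorSupport`, line `ch0-null-correspondence-support`:
# stub S2 `stub_weilProjectorNormalForm_of_bloch` (Beauville–Bloch normal form of the Weil projector)

The registered stub S2 of the skeleton `Cruxes/MiddleDivisorSupport/Lines/ch0_null_correspondence_support`
(crux stmt-HodgeConjecture-1081) in its reshaped form `BlochPontryaginVanishing → WeilProjectorNormalForm`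
(statements of `Theorems/LinearSystemTorelliDefs`): GIVEN Bloch's theorem `I^{⋆(g+1)} = 0` on the pair
`(P, φP)` (`pontryaginMonomial A φ P a b = 0` for `a + b > dim A`), for an abelian `2n`-fold `A`, an
endomorphism `φ`, `d ≥ 1`, Weil-projector coefficients `(q, m)` (`IsWeilProjectorCoefficients n d q m`)
and every complex point `P`: `M₁ · Σ q(x,y) {xP + yφP} = m · W_{2n}(P)` in `CH₀(A)` with
`M₁ = 2^{2n-1} dⁿ (2n)!` and `W_{2n}(P) = Σᵢ (-1)ⁱ C(2n,2i) d^{n-i} u^{⋆(2n-2i)} ⋆ v^{⋆2i}`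
(`weilPontryaginClass`). PROVED here; pure algebra (the hypothesis `φ ≫ φ = -d` is not even used).

## Proof

* DICTIONARY. For fixed `(A, φ, P)` the additive map `Ψ : ℤ[s,t] → CH₀(A)`, `sˣtʸ ↦ {xP + yφP}`
  (`= endoPointClass A φ x y P`) sends `(s-1)ᵃ(t-1)ᵇ ↦ pontryaginMonomial A φ P a b` (binomial
  theorem; the definition of `pontryaginMonomial` is this expansion), hence `Σ q(x,y) sˣtʸ ↦
  weilProjectorOnPoint` and `Σᵢ cᵢ (s-1)^{2n-2i}(t-1)^{2i} ↦ weilPontryaginClass`, `cᵢ = (-1)ⁱ C(2n,2i) d^{n-i}`.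
* REDUCTION. `F := M₁ Σ q(x,y) sˣtʸ - m Σᵢ cᵢ (s-1)^{2n-2i}(t-1)^{2i}` is the shift `s ↦ s-1, t ↦ t-1`
  of `D := M₁ Σ q(x,y) (1+s)ˣ(1+t)ʸ - m Σᵢ cᵢ s^{2n-2i} t^{2i}`; if every coefficient of `D` in total
  degree `≤ 2n` vanishes, then `F = Σ_{|μ| > 2n} [μ]D · (s-1)^{μ₀}(t-1)^{μ₁}` and `Ψ F = 0` by Bloch.
* COEFFICIENTS. `[sᵃtᵇ] Σ q(x,y)(1+s)ˣ(1+t)ʸ = Σ q(x,y) C(x,a) C(y,b)`, and `a!·C(x,a)` is the value at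
  `x` of the MONIC degree-`a` polynomial `descPochhammer a`, so these coefficients are governed by the
  power sums `p(a,b) = Σ q(x,y) xᵃyᵇ`. With `ι = i√d`, `z = x + ιy`, `w = x - ιy`: `2x = z + w`,
  `2ιy = z - w`, so `2ᵃ(2ι)ᵇ p(a,b) = Σ_{i,j} C(a,i)C(b,j)(-1)^{b-j} Σ q z^{i+j} w^{a+b-i-j}`, and the
  character sums `Σ q zᵃ'wᵇ' = m·𝟙_S(a',b')` (`IsWeilProjectorCoefficients`, `a', b' ≤ 2n`) give
  `2ᵃ(2ι)ᵇ p(a,b) = 𝟙[a+b=2n]·m·(1 + (-1)ᵇ)` for `a + b ≤ 2n`. Hence (integer identities proved in `ℂ`)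
  `Σ q C(x,a)C(y,b) = 0` for `a + b ≤ 2n` unless `(a, b) = (2n-2i, 2i)`, where
  `M₁ Σ q C(x,2n-2i) C(y,2i) = m (-1)ⁱ C(2n,2i) d^{n-i}` — the coefficients of `m Σᵢ cᵢ s^{2n-2i}t^{2i}`.

No new definitions (`Ψ` is obtained by `obtain`, the shift is `MvPolynomial.aeval`); `ι² = -d`, `ι ≠ 0`
are the tree's `HodgeTheory.I_mul_sqrt_sq`, `I_mul_sqrt_ne_zero`. NOT here: Bloch's theorem itself (the
hypothesis `BlochPontryaginVanishing`, Bloch 1976 Thm. 0.1), the neighbouring stubs S1 (`q, m` are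
HYPOTHESES here), S3, F1–F3, and any geometry.

## References

* [Bloch1976] S. Bloch, Some elementary theorems about algebraic cycles on Abelian varieties, Thm. 0.1
  (the vanishing consumed as hypothesis) and §1 (the Pontryagin-power bookkeeping `{P} ⋆ {Q} = {P+Q}`).
* [Beauville1986] A. Beauville, Sur l'anneau de Chow d'une variété abélienne (behind `W_{2n}`; informal).
-/

noncomputable section

-- `Summit.HodgeConjecture.HodgeConjecture.Theorems` is the mandated namespace (single-problem summit:
-- Problem = Summit), which `linter.dupNamespace` flags on every declaration; the lakefile turns the
-- linter off tree-wide (weak option), restated here so stand-alone elaboration is warning-free too.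
set_option linter.dupNamespace false

namespace Summit.HodgeConjecture.HodgeConjecture.Theorems.Ch0Null

namespace WeilNormalForm

open MvPolynomial Finset Literature.AlgebraicGeometry.HodgeTheory
open scoped Nat

/-! ### The dictionary `ℤ[s,t] → CH₀(A)`: integer polynomial bookkeeping -/

/-- The exponent `x·e₀ + y·e₁` equals `μ` iff `(x, y) = (μ 0, μ 1)`. -/
theorem single_add_single_eq_iff (x y : ℕ) (μ : Fin 2 →₀ ℕ) :
    Finsupp.single (0 : Fin 2) x + Finsupp.single 1 y = μ ↔ (x, y) = (μ 0, μ 1) := by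
  refine ⟨by rintro rfl; simp, fun h => ?_⟩
  obtain ⟨rfl, rfl⟩ := Prod.mk.inj h
  ext i
  fin_cases i <;> simp

/-- Coefficients of the monomial `sˣ tʸ`. -/
theorem coeff_X_pow_mul_X_pow (μ : Fin 2 →₀ ℕ) (x y : ℕ) :
    coeff μ (X 0 ^ x * X 1 ^ y : MvPolynomial (Fin 2) ℤ) = if (x, y) = (μ 0, μ 1) then 1 else 0 := by
  rw [X_pow_eq_monomial, X_pow_eq_monomial, monomial_mul, mul_one, coeff_monomial]
  simp only [single_add_single_eq_iff]

/-- Coefficients of `(1+s)ˣ (1+t)ʸ`: `[sᵃtᵇ] = C(x,a) C(y,b)`. -/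
theorem coeff_X_add_one_pow_mul (μ : Fin 2 →₀ ℕ) (x y : ℕ) :
    coeff μ ((X 0 + 1) ^ x * (X 1 + 1) ^ y : MvPolynomial (Fin 2) ℤ) =
      (x.choose (μ 0) : ℤ) * (y.choose (μ 1) : ℤ) := by
  have h : ((X 0 + 1) ^ x * (X 1 + 1) ^ y : MvPolynomial (Fin 2) ℤ) = ∑ p ∈ range (x + 1) ×ˢ range (y + 1),
      C ((x.choose p.1 : ℤ) * (y.choose p.2 : ℤ)) * (X 0 ^ p.1 * X 1 ^ p.2) := by
    rw [add_pow, add_pow, Finset.sum_mul_sum, Finset.sum_product]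
    refine Finset.sum_congr rfl fun i _ => Finset.sum_congr rfl fun j _ => ?_
    simp only [one_pow, mul_one, map_mul, map_natCast]
    ring
  rw [h, coeff_sum]
  simp_rw [coeff_C_mul, coeff_X_pow_mul_X_pow, mul_ite, mul_one, mul_zero, Prod.mk.eta]
  rw [Finset.sum_ite_eq']
  split_ifs with hmem
  · rfl
  · simp only [Finset.mem_product, Finset.mem_range, not_and_or, not_lt] at hmem
    rcases hmem with h' | h'
    · rw [Nat.choose_eq_zero_of_lt (show x < μ 0 by omega), Nat.cast_zero, zero_mul]
    · rw [Nat.choose_eq_zero_of_lt (show y < μ 1 by omega), Nat.cast_zero, mul_zero]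

/-- Binomial expansion of `c (s-1)ᵃ (t-1)ᵇ` (the shape of `pontryaginMonomial`). -/
theorem C_mul_X_sub_one_pow_mul (c : ℤ) (a b : ℕ) :
    C c * ((X 0 - 1) ^ a * (X 1 - 1) ^ b : MvPolynomial (Fin 2) ℤ) = ∑ i ∈ range (a + 1), ∑ j ∈ range (b + 1),
      C (c * ((-1) ^ (a - i + (b - j)) * (a.choose i : ℤ) * (b.choose j : ℤ))) * (X 0 ^ i * X 1 ^ j) := by
  rw [sub_eq_add_neg, sub_eq_add_neg, add_pow, add_pow, Finset.sum_mul_sum, Finset.mul_sum]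
  refine Finset.sum_congr rfl fun i _ => ?_
  rw [Finset.mul_sum]
  refine Finset.sum_congr rfl fun j _ => ?_
  simp only [map_mul, map_pow, map_neg, map_one, map_natCast, pow_add]
  ring

/-- Existence of the dictionary `Ψ : ℤ[s,t] →+ G`, `c sˣ tʸ ↦ c • e x y`. -/
theorem exists_dictionary {G : Type*} [AddCommGroup G] (e : ℕ → ℕ → G) :
    ∃ Ψ : MvPolynomial (Fin 2) ℤ →+ G, ∀ (x y : ℕ) (c : ℤ), Ψ (C c * (X 0 ^ x * X 1 ^ y)) = c • e x y := by
  refine ⟨(Finsupp.liftAddHom fun μ : Fin 2 →₀ ℕ => (smulAddHom ℤ G).flip (e (μ 0) (μ 1))).comp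
      (AddMonoidAlgebra.coeffAddEquiv (R := ℤ) (M := Fin 2 →₀ ℕ)).toAddMonoidHom, fun x y c => ?_⟩
  rw [X_pow_eq_monomial, X_pow_eq_monomial, monomial_mul, mul_one, C_mul_monomial, mul_one]
  change Finsupp.liftAddHom _ (Finsupp.single _ c) = _
  rw [Finsupp.liftAddHom_apply_single]
  simp

/-- The dictionary on `c (s-1)ᵃ (t-1)ᵇ`: `c •` the expanded Pontryagin monomial. -/
theorem dictionary_X_sub_one_pow {G : Type*} [AddCommGroup G] {e : ℕ → ℕ → G}
    {Ψ : MvPolynomial (Fin 2) ℤ →+ G} (hΨ : ∀ (x y : ℕ) (c : ℤ), Ψ (C c * (X 0 ^ x * X 1 ^ y)) = c • e x y)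
    (c : ℤ) (a b : ℕ) :
    Ψ (C c * ((X 0 - 1) ^ a * (X 1 - 1) ^ b)) = c • ∑ i ∈ range (a + 1), ∑ j ∈ range (b + 1),
      ((-1 : ℤ) ^ (a - i + (b - j)) * (a.choose i : ℤ) * (b.choose j : ℤ)) • e i j := by
  rw [C_mul_X_sub_one_pow_mul, map_sum, Finset.smul_sum]
  refine Finset.sum_congr rfl fun i _ => ?_
  rw [map_sum, Finset.smul_sum]
  exact Finset.sum_congr rfl fun j _ => by rw [hΨ, mul_smul]

/-- REDUCTION: an additive map killing the shifted monomials of degree `> N` kills the shift of every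
polynomial whose coefficients vanish in degree `≤ N`. -/
theorem map_aeval_eq_zero {G : Type*} [AddCommGroup G] (Ψ : MvPolynomial (Fin 2) ℤ →+ G)
    (τ : MvPolynomial (Fin 2) ℤ →ₐ[ℤ] MvPolynomial (Fin 2) ℤ) (pm : ℕ → ℕ → G) (N : ℕ)
    (hΨ : ∀ (μ : Fin 2 →₀ ℕ) (c : ℤ), Ψ (τ (monomial μ c)) = c • pm (μ 0) (μ 1))
    (hpm : ∀ a b : ℕ, N < a + b → pm a b = 0) {D : MvPolynomial (Fin 2) ℤ}
    (hD : ∀ μ : Fin 2 →₀ ℕ, μ 0 + μ 1 ≤ N → coeff μ D = 0) : Ψ (τ D) = 0 := by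
  rw [as_sum D, map_sum, map_sum]
  refine Finset.sum_eq_zero fun μ _ => ?_
  rw [hΨ]
  by_cases h : μ 0 + μ 1 ≤ N
  · rw [hD μ h, zero_smul]
  · rw [hpm _ _ (not_le.mp h), smul_zero]

/-- The shift `s ↦ s-1, t ↦ t-1` carries `D = Σ M q(x,y) (1+s)ˣ(1+t)ʸ - Σᵢ cᵢ s^{aᵢ} t^{bᵢ}` to
`F = Σ M q(x,y) sˣtʸ - Σᵢ cᵢ (s-1)^{aᵢ} (t-1)^{bᵢ}`. -/
theorem aeval_sub_one_D (q : ℕ × ℕ →₀ ℤ) (M : ℤ) (s : Finset ℕ) (c : ℕ → ℤ) (ea eb : ℕ → ℕ) :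
    aeval (fun i : Fin 2 => (X i : MvPolynomial (Fin 2) ℤ) - 1)
      (∑ xy ∈ q.support, C (M * q xy) * ((X 0 + 1) ^ xy.1 * (X 1 + 1) ^ xy.2) -
        ∑ i ∈ s, C (c i) * (X 0 ^ ea i * X 1 ^ eb i)) =
      ∑ xy ∈ q.support, C (M * q xy) * (X 0 ^ xy.1 * X 1 ^ xy.2) -
        ∑ i ∈ s, C (c i) * ((X 0 - 1) ^ ea i * (X 1 - 1) ^ eb i) := by
  simp only [map_sub, map_sum, map_mul, map_pow, map_add, map_one, aeval_X, algHom_C, algebraMap_eq,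
    sub_add_cancel]

/-! ### The character sums: complex-number bookkeeping and the integer identities -/

section Complex

variable {n d m : ℕ} {q : ℕ × ℕ →₀ ℤ} {ι : ℂ}

/-- The hypothesis `IsWeilProjectorCoefficients` with `z = x + ιy`, `w = x - ιy`. -/
theorem sum_char_eq (hι : ι = Complex.I * (Real.sqrt d : ℂ)) (hq : IsWeilProjectorCoefficients n d q m)
    {a b : ℕ} (ha : a ≤ 2 * n) (hb : b ≤ 2 * n) :
    ∑ xy ∈ q.support, (q xy : ℂ) * (((xy.1 : ℂ) + xy.2 * ι) ^ a * ((xy.1 : ℂ) - xy.2 * ι) ^ b) =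
      if (a = 2 * n ∧ b = 0) ∨ (a = 0 ∧ b = 2 * n) then (m : ℂ) else 0 := by
  rw [← hq a b ha hb]
  exact Finset.sum_congr rfl fun xy _ => by rw [weilCharacter, hι]; ring

/-- Interchanging a weighted sum with a double sum. -/
theorem sum_mul_sum_sum {α : Type*} (s : Finset α) (sa sb : Finset ℕ) (w : α → ℂ) (c : ℕ → ℕ → ℂ)
    (t : ℕ → ℕ → α → ℂ) : ∑ x ∈ s, w x * ∑ i ∈ sa, ∑ j ∈ sb, c i j * t i j x =
      ∑ i ∈ sa, ∑ j ∈ sb, c i j * ∑ x ∈ s, w x * t i j x := by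
  simp only [Finset.mul_sum]
  rw [Finset.sum_comm]
  refine Finset.sum_congr rfl fun i _ => ?_
  rw [Finset.sum_comm]
  exact Finset.sum_congr rfl fun j _ => Finset.sum_congr rfl fun x _ => by ring

/-- The indicator double sum: on `i ≤ a`, `j ≤ b`, `a + b = 2n ≥ 2`, the condition
`𝟙_S(i+j, a+b-i-j)` holds exactly at `(i,j) = (a,b)` and `(i,j) = (0,0)`. -/
theorem sum_sum_ite (hn : 0 < n) {a b : ℕ} (hab : a + b = 2 * n) (g : ℕ → ℕ → ℂ) :
    ∑ i ∈ range (a + 1), ∑ j ∈ range (b + 1),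
      (if (i + j = 2 * n ∧ a - i + (b - j) = 0) ∨ (i + j = 0 ∧ a - i + (b - j) = 2 * n)
        then g i j else 0) = g a b + g 0 0 := by
  rw [← Finset.sum_product', Finset.sum_eq_add (a, b) (0, 0)]
  · rw [if_pos (Or.inl ⟨hab, by simp⟩), if_pos (Or.inr ⟨rfl, by simpa using hab⟩)]
  · exact fun h => by rw [Prod.mk.injEq] at h; omega
  · rintro ⟨i, j⟩ hmem ⟨h1, h2⟩
    simp only [Finset.mem_product, Finset.mem_range, Ne, Prod.mk.injEq] at hmem h1 h2
    exact if_neg (by omega)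
  all_goals exact fun h => absurd (Finset.mem_product.2 ⟨by simp, by simp⟩) h

/-- SCALED POWER SUMS: `2ᵃ (2ι)ᵇ Σ q(x,y) xᵃ yᵇ = 𝟙[a+b = 2n] · m · (1 + (-1)ᵇ)` for `a + b ≤ 2n`. -/
theorem pow_sum_eq (hn : 0 < n) (hι : ι = Complex.I * (Real.sqrt d : ℂ))
    (hq : IsWeilProjectorCoefficients n d q m) {a b : ℕ} (hab : a + b ≤ 2 * n) :
    (2 : ℂ) ^ a * (2 * ι) ^ b * ∑ xy ∈ q.support, (q xy : ℂ) * ((xy.1 : ℂ) ^ a * (xy.2 : ℂ) ^ b) =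
      if a + b = 2 * n then (m : ℂ) * (1 + (-1) ^ b) else 0 := by
  have hexp : ∀ xy : ℕ × ℕ, (2 : ℂ) ^ a * (2 * ι) ^ b * ((q xy : ℂ) * ((xy.1 : ℂ) ^ a * (xy.2 : ℂ) ^ b)) =
      (q xy : ℂ) * ∑ i ∈ range (a + 1), ∑ j ∈ range (b + 1),
        ((a.choose i : ℂ) * (b.choose j : ℂ) * (-1) ^ (b - j)) *
          (((xy.1 : ℂ) + xy.2 * ι) ^ (i + j) * ((xy.1 : ℂ) - xy.2 * ι) ^ (a - i + (b - j))) := by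
    intro xy
    have h2 : (2 : ℂ) ^ a * (2 * ι) ^ b * ((q xy : ℂ) * ((xy.1 : ℂ) ^ a * (xy.2 : ℂ) ^ b)) =
        (q xy : ℂ) * ((((xy.1 : ℂ) + xy.2 * ι) + ((xy.1 : ℂ) - xy.2 * ι)) ^ a *
          (((xy.1 : ℂ) + xy.2 * ι) + -((xy.1 : ℂ) - xy.2 * ι)) ^ b) := by
      ring
    rw [h2, add_pow, add_pow, Finset.sum_mul_sum]
    congr 1
    refine Finset.sum_congr rfl fun i _ => Finset.sum_congr rfl fun j _ => ?_
    rw [neg_pow]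
    ring
  rw [Finset.mul_sum, Finset.sum_congr rfl fun xy _ => hexp xy, sum_mul_sum_sum]
  rw [Finset.sum_congr rfl fun i hi => Finset.sum_congr rfl fun j hj => by
    rw [sum_char_eq hι hq (by simp only [Finset.mem_range] at hi hj; omega)
      (by simp only [Finset.mem_range] at hi hj; omega)]]
  simp_rw [mul_ite, mul_zero]
  split_ifs with h
  · rw [sum_sum_ite hn h]
    simp
    ring
  · refine Finset.sum_eq_zero fun i hi => Finset.sum_eq_zero fun j hj => if_neg ?_
    simp only [Finset.mem_range] at hi hj
    omega

/-- Power sums of total degree `< 2n` vanish. -/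
theorem pow_sum_eq_zero (hn : 0 < n) (hd : 0 < d) (hι : ι = Complex.I * (Real.sqrt d : ℂ))
    (hq : IsWeilProjectorCoefficients n d q m) {a b : ℕ} (hab : a + b < 2 * n) :
    ∑ xy ∈ q.support, (q xy : ℂ) * ((xy.1 : ℂ) ^ a * (xy.2 : ℂ) ^ b) = 0 := by
  have h := pow_sum_eq hn hι hq hab.le
  rw [if_neg hab.ne] at h
  exact (mul_eq_zero.mp h).resolve_left (mul_ne_zero (pow_ne_zero _ two_ne_zero)
    (pow_ne_zero _ (mul_ne_zero two_ne_zero (hι ▸ I_mul_sqrt_ne_zero hd))))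

/-- BINOMIAL SUMS ARE POWER SUMS in degree `≤ 2n`: `a! b! Σ q C(x,a) C(y,b) = Σ q xᵃ yᵇ`
(`a! C(x,a) = descPochhammer(a)(x)`, monic of degree `a`; lower power sums vanish). -/
theorem factorial_mul_sum_choose (hn : 0 < n) (hd : 0 < d) (hι : ι = Complex.I * (Real.sqrt d : ℂ))
    (hq : IsWeilProjectorCoefficients n d q m) {a b : ℕ} (hab : a + b ≤ 2 * n) :
    ((a ! : ℂ) * b !) * ∑ xy ∈ q.support, (q xy : ℂ) * ((xy.1.choose a : ℂ) * (xy.2.choose b : ℂ)) =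
      ∑ xy ∈ q.support, (q xy : ℂ) * ((xy.1 : ℂ) ^ a * (xy.2 : ℂ) ^ b) := by
  have hdeg : ∀ k, (descPochhammer ℂ k).natDegree < k + 1 := fun k => by simp
  have hlead : ∀ k, (descPochhammer ℂ k).coeff k = 1 := fun k => by
    simpa using (monic_descPochhammer ℂ k).coeff_natDegree
  have hev : ∀ k x : ℕ, (k ! : ℂ) * (x.choose k : ℂ) =
      ∑ i ∈ range (k + 1), (descPochhammer ℂ k).coeff i * (x : ℂ) ^ i := fun k x => by
    rw [← Polynomial.eval_eq_sum_range' (hdeg k), descPochhammer_eval_eq_descFactorial,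
      Nat.descFactorial_eq_factorial_mul_choose, Nat.cast_mul]
  calc ((a ! : ℂ) * b !) * ∑ xy ∈ q.support, (q xy : ℂ) * ((xy.1.choose a : ℂ) * (xy.2.choose b : ℂ))
      = ∑ xy ∈ q.support, (q xy : ℂ) *
          (((a ! : ℂ) * (xy.1.choose a : ℂ)) * ((b ! : ℂ) * (xy.2.choose b : ℂ))) := by
        rw [Finset.mul_sum]
        exact Finset.sum_congr rfl fun xy _ => by ring
    _ = ∑ xy ∈ q.support, (q xy : ℂ) * ∑ i ∈ range (a + 1), ∑ j ∈ range (b + 1),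
          ((descPochhammer ℂ a).coeff i * (descPochhammer ℂ b).coeff j) *
            ((xy.1 : ℂ) ^ i * (xy.2 : ℂ) ^ j) := by
        refine Finset.sum_congr rfl fun xy _ => ?_
        rw [hev, hev, Finset.sum_mul_sum]
        congr 1
        exact Finset.sum_congr rfl fun i _ => Finset.sum_congr rfl fun j _ => by ring
    _ = ∑ i ∈ range (a + 1), ∑ j ∈ range (b + 1),
          ((descPochhammer ℂ a).coeff i * (descPochhammer ℂ b).coeff j) *
            ∑ xy ∈ q.support, (q xy : ℂ) * ((xy.1 : ℂ) ^ i * (xy.2 : ℂ) ^ j) := sum_mul_sum_sum ..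
    _ = ∑ xy ∈ q.support, (q xy : ℂ) * ((xy.1 : ℂ) ^ a * (xy.2 : ℂ) ^ b) := by
        rw [Finset.sum_eq_single_of_mem a (by simp) fun i hi hia => ?_,
          Finset.sum_eq_single_of_mem b (by simp) fun j hj hjb => ?_, hlead, hlead, one_mul, one_mul]
        · rw [pow_sum_eq_zero hn hd hι hq (by have := Finset.mem_range.1 hj; omega), mul_zero]
        · exact Finset.sum_eq_zero fun j hj => by rw [pow_sum_eq_zero hn hd hι hq (by
            have := Finset.mem_range.1 hi; have := Finset.mem_range.1 hj; omega), mul_zero]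

/-- (i)+(ii): `Σ q C(x,a) C(y,b) = 0` for `a + b ≤ 2n` unless `a + b = 2n` and `b` is even. -/
theorem sum_choose_eq_zero (hn : 0 < n) (hd : 0 < d) (hι : ι = Complex.I * (Real.sqrt d : ℂ))
    (hq : IsWeilProjectorCoefficients n d q m) {a b : ℕ} (hab : a + b ≤ 2 * n)
    (hne : ¬(a + b = 2 * n ∧ Even b)) :
    ∑ xy ∈ q.support, q xy * ((xy.1.choose a : ℤ) * (xy.2.choose b : ℤ)) = 0 := by
  have h := pow_sum_eq hn hι hq hab
  rw [← factorial_mul_sum_choose hn hd hι hq hab, ← mul_assoc] at h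
  have h0 : (if a + b = 2 * n then (m : ℂ) * (1 + (-1) ^ b) else 0) = 0 := by
    split_ifs with h'
    · rw [(Nat.not_even_iff_odd.1 fun hb => hne ⟨h', hb⟩).neg_one_pow]
      ring
    · rfl
  rw [h0] at h
  have hι0 : ι ≠ 0 := hι ▸ I_mul_sqrt_ne_zero hd
  have hK : (2 : ℂ) ^ a * (2 * ι) ^ b * ((a ! : ℂ) * b !) ≠ 0 :=
    mul_ne_zero (mul_ne_zero (pow_ne_zero _ two_ne_zero) (pow_ne_zero _ (mul_ne_zero two_ne_zero hι0)))
      (mul_ne_zero (Nat.cast_ne_zero.2 (Nat.factorial_ne_zero a))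
        (Nat.cast_ne_zero.2 (Nat.factorial_ne_zero b)))
  exact_mod_cast (mul_eq_zero.1 h).resolve_left hK

/-- (iii): `M₁ Σ q C(x,2n-2i) C(y,2i) = m (-1)ⁱ C(2n,2i) d^{n-i}`, `M₁ = 2^{2n-1} dⁿ (2n)!`. -/
theorem M₁_mul_sum_choose (hn : 0 < n) (hd : 0 < d) (hι : ι = Complex.I * (Real.sqrt d : ℂ))
    (hq : IsWeilProjectorCoefficients n d q m) {i : ℕ} (hi : i ≤ n) :
    ((2 ^ (2 * n - 1) * d ^ n * (2 * n)! : ℕ) : ℤ) *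
        ∑ xy ∈ q.support, q xy * ((xy.1.choose (2 * n - 2 * i) : ℤ) * (xy.2.choose (2 * i) : ℤ)) =
      (m : ℤ) * ((-1) ^ i * ((2 * n).choose (2 * i) : ℤ) * (d : ℤ) ^ (n - i)) := by
  obtain ⟨k, rfl⟩ : ∃ k, n = i + k := ⟨n - i, by omega⟩
  have e1 : 2 * (i + k) - 2 * i = 2 * k := by omega
  rw [e1, Nat.add_sub_cancel_left]
  have h := pow_sum_eq hn hι hq (a := 2 * k) (b := 2 * i) (by omega)
  rw [← factorial_mul_sum_choose hn hd hι hq (by omega), ← mul_assoc, if_pos (by omega)] at h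
  have hι2 : ι ^ 2 = -(d : ℂ) := hι ▸ I_mul_sqrt_sq d
  have hP : (2 : ℂ) ^ (2 * (i + k) - 1) = 2 ^ (2 * k) * 2 ^ (2 * i) / 2 := by
    rw [eq_div_iff two_ne_zero, ← pow_succ, Nat.sub_add_cancel (by omega)]
    ring
  have hF : ((2 * (i + k))! : ℂ) = ((2 * (i + k)).choose (2 * i) : ℂ) * (2 * i)! * (2 * k)! := by
    rw [← e1]
    exact_mod_cast (Nat.choose_mul_factorial_mul_factorial (by omega : 2 * i ≤ 2 * (i + k))).symm
  have hI : (2 * ι) ^ (2 * i) = (-1) ^ i * 2 ^ (2 * i) * (d : ℂ) ^ i := by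
    rw [pow_mul, pow_mul, ← mul_pow, ← mul_pow, mul_pow, hι2]
    ring
  have hE : (-1 : ℂ) ^ i * (-1) ^ i = 1 := by rw [← mul_pow, neg_one_mul, neg_neg, one_pow]
  have h1 : (-1 : ℂ) ^ (2 * i) = 1 := by rw [pow_mul, neg_one_sq, one_pow]
  rw [hI, h1] at h
  apply Int.cast_injective (α := ℂ)
  push_cast at h ⊢
  rw [hP, hF]
  linear_combination ((-1 : ℂ) ^ i * ((2 * (i + k)).choose (2 * i) : ℂ) * (d : ℂ) ^ k / 2) * h -
    ((2 : ℂ) ^ (2 * k) * 2 ^ (2 * i) * (d : ℂ) ^ i * (d : ℂ) ^ k * ((2 * (i + k)).choose (2 * i) : ℂ) *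
      (2 * k)! * (2 * i)! *
      (∑ xy ∈ q.support, (q xy : ℂ) * ((xy.1.choose (2 * k) : ℂ) * (xy.2.choose (2 * i) : ℂ))) / 2) * hE

/-- (i)–(iii) COMBINED: `M₁ Σ q C(x,a) C(y,b)` is the `sᵃtᵇ`-coefficient of `m Σᵢ cᵢ s^{2n-2i} t^{2i}`. -/
theorem key_sum (hn : 0 < n) (hd : 0 < d) (hι : ι = Complex.I * (Real.sqrt d : ℂ))
    (hq : IsWeilProjectorCoefficients n d q m) {a b : ℕ} (hab : a + b ≤ 2 * n) :
    ((2 ^ (2 * n - 1) * d ^ n * (2 * n)! : ℕ) : ℤ) *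
        ∑ xy ∈ q.support, q xy * ((xy.1.choose a : ℤ) * (xy.2.choose b : ℤ)) =
      ∑ i ∈ range (n + 1), if (2 * n - 2 * i, 2 * i) = (a, b) then
        (m : ℤ) * ((-1) ^ i * ((2 * n).choose (2 * i) : ℤ) * (d : ℤ) ^ (n - i)) else 0 := by
  by_cases h : a + b = 2 * n ∧ Even b
  · obtain ⟨hab', i, hi⟩ := h
    have hin : i ≤ n := by omega
    rw [Finset.sum_eq_single_of_mem i (Finset.mem_range.2 (by omega)) fun j _ hji => if_neg fun h' => ?_]
    · rw [if_pos (by rw [Prod.mk.injEq]; omega)]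
      obtain rfl : a = 2 * n - 2 * i := by omega
      obtain rfl : b = 2 * i := by omega
      exact M₁_mul_sum_choose hn hd hι hq hin
    · rw [Prod.mk.injEq] at h'
      omega
  · rw [sum_choose_eq_zero hn hd hι hq hab h, mul_zero]
    refine (Finset.sum_eq_zero fun i _ => if_neg fun h' => h ?_).symm
    rw [Prod.mk.injEq] at h'
    exact ⟨by omega, ⟨i, by omega⟩⟩

end Complex

/-- CLAIM (A): the coefficients of `D = M₁ Σ q(x,y)(1+s)ˣ(1+t)ʸ - m Σᵢ cᵢ s^{2n-2i}t^{2i}` vanish in total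
degree `≤ 2n`. -/
theorem coeff_D_eq_zero {n d m : ℕ} {q : ℕ × ℕ →₀ ℤ} (hn : 0 < n) (hd : 0 < d)
    (hq : IsWeilProjectorCoefficients n d q m) (μ : Fin 2 →₀ ℕ) (hμ : μ 0 + μ 1 ≤ 2 * n) :
    coeff μ (∑ xy ∈ q.support, C (((2 ^ (2 * n - 1) * d ^ n * (2 * n)! : ℕ) : ℤ) * q xy) *
        ((X 0 + 1) ^ xy.1 * (X 1 + 1) ^ xy.2) -
      ∑ i ∈ range (n + 1), C ((m : ℤ) * ((-1) ^ i * ((2 * n).choose (2 * i) : ℤ) * (d : ℤ) ^ (n - i))) *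
        (X 0 ^ (2 * n - 2 * i) * X 1 ^ (2 * i) : MvPolynomial (Fin 2) ℤ)) = 0 := by
  simp only [coeff_sub, coeff_sum, coeff_C_mul, coeff_X_add_one_pow_mul, coeff_X_pow_mul_X_pow, mul_ite,
    mul_one, mul_zero]
  rw [Finset.sum_congr rfl fun xy _ => mul_assoc _ (q xy) _, ← Finset.mul_sum, key_sum hn hd rfl hq hμ,
    sub_self]

end WeilNormalForm

open MvPolynomial WeilNormalForm in
/-- **Stub S2 — Beauville–Bloch normal form of the Weil projector on `0`-cycles, GIVEN Bloch's
vanishing** (registered stub `stub_weilProjectorNormalForm_of_bloch` of the line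
`ch0-null-correspondence-support`, crux stmt-HodgeConjecture-1081): if `pontryaginMonomial A φ P a b = 0`
whenever `a + b > dim A` (Bloch 1976, Thm. 0.1), then for `dim A = 2n`, `d ≥ 1` and Weil-projector
coefficients `(q, m)`, `M₁ · Σ q(x,y){xP + yφP} = m · W_{2n}(P)` in `CH₀(A)` for every `P`, with
`M₁ = 2^{2n-1} dⁿ (2n)! ≥ 1`. Proof: module docstring (dictionary `sˣtʸ ↦ {xP + yφP}`, shift to
`(s-1, t-1)`, the low coefficients vanish by the character sums). -/
theorem stub_weilProjectorNormalForm_of_bloch : BlochPontryaginVanishing → WeilProjectorNormalForm := by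
  intro hB A φ n d hn hd hA _hφ q m _hm hq
  refine ⟨2 ^ (2 * n - 1) * d ^ n * (2 * n).factorial, m,
    Nat.mul_pos (Nat.mul_pos (Nat.pow_pos two_pos) (Nat.pow_pos hd)) (Nat.factorial_pos _), fun P => ?_⟩
  obtain ⟨Ψ, hΨ⟩ := exists_dictionary fun x y => endoPointClass A φ x y P
  have h1 : (((2 ^ (2 * n - 1) * d ^ n * (2 * n).factorial : ℕ) : ℤ)) • weilProjectorOnPoint A φ q P =
      Ψ (∑ xy ∈ q.support, C (((2 ^ (2 * n - 1) * d ^ n * (2 * n).factorial : ℕ) : ℤ) * q xy) *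
        (X 0 ^ xy.1 * X 1 ^ xy.2)) := by
    rw [map_sum, weilProjectorOnPoint, Finset.smul_sum]
    exact Finset.sum_congr rfl fun xy _ => by rw [hΨ, mul_smul]
  have h2 : (m : ℤ) • weilPontryaginClass A φ n d P = Ψ (∑ i ∈ Finset.range (n + 1),
      C ((m : ℤ) * ((-1) ^ i * ((2 * n).choose (2 * i) : ℤ) * (d : ℤ) ^ (n - i))) *
        ((X 0 - 1) ^ (2 * n - 2 * i) * (X 1 - 1) ^ (2 * i))) := by
    rw [map_sum, weilPontryaginClass, Finset.smul_sum]
    exact Finset.sum_congr rfl fun i _ => by rw [dictionary_X_sub_one_pow hΨ, mul_smul (m : ℤ)]; rfl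
  rw [← natCast_zsmul, h1, h2, ← sub_eq_zero, ← map_sub, ← aeval_sub_one_D]
  refine map_aeval_eq_zero Ψ _ (pontryaginMonomial A φ P) (2 * n) (fun μ c => ?_)
    (fun a b hab => hB A φ P a b (hA ▸ hab)) (coeff_D_eq_zero hn hd hq)
  rw [aeval_monomial, Finsupp.prod_pow, Fin.prod_univ_two, algebraMap_eq, dictionary_X_sub_one_pow hΨ]
  rfl

end Summit.HodgeConjecture.HodgeConjecture.Theorems.Ch0Null

end
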